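import Summits.QuantumFields.BalabanUV.T4Continuum.Support.NE9Lemma1SpeciesEnd
import Summits.QuantumFields.BalabanUV.T4Continuum.Support.NE9Lemma1KernelSpeciesAdditive

/-!
# NE9Lemma1SpeciesEndAdditive — the NE9 END (`…_compProj` face) at the ASSEMBLED species channel 𝒯 = 𝒯_(a) + 𝒯_(b) of
# [I] §§3–4 (row owner t4-ne9-p1-g25, `NE9Lemma1SpeciesEnd` p215007) WITH THE SPECIES-(b) ADDITIVITY BINDER DISCHARGED BY NAME
# from crew row (w23) (`NE9Lemma1KernelSpeciesAdditive.pieceAdditiveOn_ker`, p214868) — cell `pub-balaban`, T4-DAG §2 node U3 /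
# §6 NE9; rung (B)+1 on a FIXED finite T⁴; NE9 formalisation swarm, unit `b2b-balaban-t4-ne9-formalise-leaf-01` gen 7, own-lineage
# follow-through «END-SPECIES-S3» of (w23) (journal CLAIM l.11187); nothing of any import is modified

HONEST FRAMING (T4-DAG PAGE 1).  Rung (B)+1 = existence and uniqueness of the ε → 0 limit of gauge-invariant observables on a
FIXED finite torus T⁴ — NOT infinite volume, NOT a mass gap, NOT the Clay problem.  NE9 (`T4OutputRate.NE9` ∧ `FadingMemory`) is
a cell NEW ESTIMATE, NOT PRINTED and NOT discharged here («NE9 ⇐ the named binders»); spine 0/9.  HONEST DEPENDENCY (cell line,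
verbatim): continuum YM on T⁴ ⇐ BetaPertH ∧ nine spine estimates (0/9 proved); BetaPertH ⇐ (D1) ∧ (D4) ∧ CAP+tail; G-an2-4 gates
asym, D1 and NE2/3/4.  `FlowStep.BetaPertH`, (B), (B^μ) do not occur.  [I] = [Balaban1987RG1] (CMP **109**), [II] =
[Balaban1988RG2Cluster] (CMP **116**) are quoted for TYPES only (ABSOLUTE RULE: nothing printed in the audited series is asserted).

WHAT THIS FILE IS.  The owner's gen-25 END face `NE9Lemma1SpeciesEnd.termSize_ne9_and_fadingMemory_species_compProj` feeds the
skeleton's END on the corrected dictionary with the FULL species channel of [I] §§3–4, `𝒯 := cpieceChannel D.toC + cpieceChannel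
K.toC` ((a) the fifth-order remainder along Bałaban's slice curves, `CurData`; (b) the point-localized terms of §4, `KerData`), and
DISPLAYS the two S3 piece-additivity binders `hAa : PieceAdditiveOn (analyticClass D.R) D.toC` ((w19)) and
`hAb : PieceAdditiveOn (analyticClass K.R) K.toC` ((w23)).  Crew row (w23) (this lineage, gen 6, p214868) PROVED the second one on
the analytic class from `0 < κ₁`, `0 < r_k` and the two summand-regularity binders of the bilocal summand — (A) `hkerA`: on old
terms analytic on the ball of radius `R_X` the summand at every pair of points of the family is SUBTRACTIVE in the old term (TYPE
[I] (4.21) p. 285 / (4.22) p. 286: the point-localized kernels are multilinear in the derivatives of the old term); (C) `hkerC`: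
for such an old term the summand is jointly continuous in the contour variables `(t, s′, σ′)`.  THIS FILE substitutes that proof
into the END face:
**`termSize_ne9_and_fadingMemory_species_compProj_addKer`** — p215007's face TOKEN FOR TOKEN with `hAb ↦ pieceAdditiveOn_ker K _
hK.r_pos hkerA hkerC` (`0 < κ₁` from `KerData.Admissible.κ₁_ge`, `0 < r_k` from `KerData.Admissible.r_pos`); (A)/(C) are displayed
in `hAb`'s place; EVERYTHING ELSE — species (a)'s binders incl. `hAa` (its discharger (w19) `pieceAdditiveOn_cur`, leaf-08-g4
p214120, is verified but not yet committed at the time of writing), the identification binders `hκ₁`/`hR`/`hdY`, the two level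
counts (at κ and at κ − w), `MF ⊆ analyticClass D.R`, and the face's own A1/A2/A3/RO-type binders and scalars — VERBATIM;
conclusion LITERALLY the face's, `ω′ = ω + 8·lipbar·B·((1 + c)·(cQ_(a) + cQ_(b)))`.
So after this file the END's displayed list for the full species channel reads: O1-type data, `CurData.Admissible` (Lemma 4 (3.53)
TYPE + gain + G1), `KerData.Admissible` ((K) p. 286 TYPE, (G), (S), G1), the two level counts, species (a)'s additivity binder
((w19)), species (b)'s SUMMAND REGULARITY (A)/(C) (instead of its additivity binder), `MF ⊆ analyticClass`, and the face's own
binders.  DISGUISE TEST: unchanged from the face (skeleton §5 (g2)) — one END-level composition BY NAME; no two-history content is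
added or removed; not NE9.

References (TYPES only): [Balaban1987RG1] T. Bałaban, CMP **109** (1987) 249–301, (3.34) p. 277, Lemma 4 (3.53)–(3.54) p. 280,
(4.21) p. 285, (4.22) p. 286; [Balaban1988RG2Cluster] T. Bałaban, CMP **116** (1988) 1–22, (1.23)–(1.29) pp. 7–8, (1.33)–(1.36)
p. 9.  Summits-side NEW work (LEAN PLACEMENT RULE); imports the owner's `NE9Lemma1SpeciesEnd` (p215007) and this lineage's
`NE9Lemma1KernelSpeciesAdditive` (p214868) ONLY; modifies nothing; 0 `def`, 0 sorry.  Value = bookkeeping: one displayed binder of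
the END for the FULL species channel replaced by its kernel discharger's displayed inputs, NOT summit progress.
-/

noncomputable section

namespace Summit.QuantumFields.BalabanUV.T4Continuum.NE9Lemma1SpeciesEndAdditive

open scoped BigOperators
open Metric
open Literature.Probability.LatticeModels
open Literature.MathematicalPhysics.QuantumFieldTheory.Balaban1983to89
open Literature.MathematicalPhysics.QuantumFieldTheory.Balaban1983to89.T4OutputRate
open Literature.MathematicalPhysics.QuantumFieldTheory.Balaban1983to89.T4HistoryLipschitzRecursion
open Literature.MathematicalPhysics.QuantumFieldTheory.Balaban1983to89.T4HistoryLipschitzOuter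
open Literature.MathematicalPhysics.QuantumFieldTheory.Balaban1983to89.T4HistoryLipschitzActivity
open Literature.MathematicalPhysics.QuantumFieldTheory.Balaban1983to89.T4HistoryLipschitzActivity (ClusterGeom)
open Literature.MathematicalPhysics.QuantumFieldTheory.Balaban1983to89.T4HistoryLipschitzSegment
open Summit.QuantumFields.BalabanUV.T4Continuum.NE9Lemma1Counting
open Summit.QuantumFields.BalabanUV.T4Continuum.NE9Lemma1Gain
open Summit.QuantumFields.BalabanUV.T4Continuum.NE9Lemma1PieceClass
open Summit.QuantumFields.BalabanUV.T4Continuum.NE9Lemma1RemainderSpecies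
open Summit.QuantumFields.BalabanUV.T4Continuum.NE9Lemma1CurveSpecies
open Summit.QuantumFields.BalabanUV.T4Continuum.NE9Lemma1KernelSpecies
open Summit.QuantumFields.BalabanUV.T4Continuum.NE9Lemma1KernelSpeciesAdditive
open Summit.QuantumFields.BalabanUV.T4Continuum.NE9Lemma1SpeciesEnd
open Summit.QuantumFields.BalabanUV.T4Continuum.NE9ComplexEncoding (doubleCarriers)
open Summit.QuantumFields.BalabanUV.T4Continuum.NE9MarginalProjection
open Summit.QuantumFields.BalabanUV.T4Continuum.NE9MarginalProjectionEnd

variable {C₀ : Carriers} {E : Type} [NormedAddCommGroup E] [NormedSpace ℂ E]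
  {ι α β γ δ α' β' γ' δ' Pt : Type} [DecidableEq δ] [DecidableEq δ']

/-- **THE NE9 END (`…_compProj` face) AT THE ASSEMBLED SPECIES CHANNEL 𝒯 = 𝒯_(a) + 𝒯_(b) WITH SPECIES (b)'s S3 BINDER
DISCHARGED** («END-SPECIES-S3» §1).  The owner's `termSize_ne9_and_fadingMemory_species_compProj` (p215007) token for token, except
that the displayed piece-additivity binder of the KERNEL species, `hAb : PieceAdditiveOn (analyticClass K.R) K.toC`, is PRODUCED by
crew row (w23)'s `NE9Lemma1KernelSpeciesAdditive.pieceAdditiveOn_ker` from `KerData.Admissible` (`1 ≤ κ₁`, `0 < r_k`) and the two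
SUMMAND-REGULARITY binders displayed here in its place — **(A) `hkerA`** (on old terms analytic on the ball of radius `R_X` the
bilocal summand is subtractive in the old term at every pair of points of the family; TYPE [I] (4.21) p. 285 / (4.22) p. 286:
multilinear in the derivatives of the old term) and **(C) `hkerC`** (for such an old term the summand is jointly continuous in the
contour variables `(t, s′, σ′)`).  Species (a)'s binders (`hD`, `hℓg`, `hLa`, `hAa`), the identification binders `hκ₁`/`hR`/`hdY`,
the level counts of (b) at `κ − w`, `MF ⊆ analyticClass D.R` and the face's own binders are VERBATIM; conclusion LITERALLY the
face's with `ω′ = ω + 8·lipbar·B·((1 + c)·(cQ_(a) + cQ_(b)))`.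
[cite: Balaban1987RG1, (3.34) p.277, (3.53)-(3.54) p.280, (4.21) p.285, (4.22) p.286; Balaban1988RG2Cluster, (1.23)-(1.29) pp.7-8, (1.33)-(1.36) p.9] -/
theorem termSize_ne9_and_fadingMemory_species_compProj_addKer (G : ClusterGeom (doubleCarriers C₀)) {Pot : Type*}
    [NormedAddCommGroup Pot] [NormedSpace ℂ Pot] {D : CurData C₀ E ι α β γ δ} {K : KerData C₀ E ι α' β' γ' δ' Pt}
    {ℓg ℓk gain : ℕ → ℕ → ℝ} {cdir cK δ₀ δ₁ w w0 c0 c1 d0 O1 cQa cQb : ℝ}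
    {Ef : Functional (doubleCarriers C₀) E} {W : Set (ℕ → ℝ)}
    {Adm MF : Set (E → (doubleCarriers C₀).Dom → ℝ)}
    {P : (E → (doubleCarriers C₀).Dom → ℝ) → (E → (doubleCarriers C₀).Dom → ℝ)}
    {Ψ : ℕ → ℝ → (ι → ℝ) → E → (doubleCarriers C₀).Dom → ℝ} {act : ℕ → ℝ → E → Pot → G.P → ℂ} {𝒜 : ℕ → Set Pot}
    {n : ℕ → ℝ → E → G.P → ℝ} {lip clip : ℕ → ℝ} {a d : G.P → ℝ} {δv : (doubleCarriers C₀).Dom → ℝ}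
    {κ B lipbar clipbar qTbar ω c : ℝ} {qT p₀ N : ℕ → ℝ}
    -- species (a): the curve datum and its binders (verbatim; `hAa` = (w19), displayed)
    (hD : D.Admissible ℓg cdir d0) (hℓg : ∀ k j, 0 ≤ ℓg k j)
    (hLa : LevelCountsG D.toC.frame κ D.κ₁ O1 cQa (fun k j => ℓg k j ^ 5) (agePow ω))
    (hAa : PieceAdditiveOn (analyticClass D.R) D.toC)
    -- species (b): the kernel datum and its binders, on the SAME κ₁ / radii / output geometry
    (hK : K.Admissible ℓk gain cK δ₀ δ₁ w w0 c0 c1 d0) (hκ₁ : K.κ₁ = D.κ₁) (hR : K.R = D.R)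
    (hdY : K.toC.frame.dY = D.toC.frame.dY)
    (hLb : LevelCountsG K.toC.frame (κ - w) K.κ₁ O1 cQb gain (agePow ω))
    -- (w23)'s displayed inputs IN PLACE OF `hAb`: summand regularity (A) subtractive in the old term, (C) jointly continuous
    (hkerA : ∀ (k : ℕ) (s : ℕ → ℝ) (y : ι) (a : α') (b : β') (x : (doubleCarriers C₀).Dom) (t : ℂ) (s' : δ' → ℝ)
      (σ' : δ' → ℂ), ∀ p ∈ K.pts k y a, ∀ q ∈ K.pts k y a, ∀ F₁ F₂ : E → ℂ,
        DifferentiableOn ℂ F₁ (ball 0 (K.R x.1)) → DifferentiableOn ℂ F₂ (ball 0 (K.R x.1)) →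
          K.ker k s y a b x t s' σ' p q (F₁ - F₂) = K.ker k s y a b x t s' σ' p q F₁ - K.ker k s y a b x t s' σ' p q F₂)
    (hkerC : ∀ (k : ℕ) (s : ℕ → ℝ) (y : ι) (a : α') (b : β') (x : (doubleCarriers C₀).Dom),
      ∀ p ∈ K.pts k y a, ∀ q ∈ K.pts k y a, ∀ F : E → ℂ, DifferentiableOn ℂ F (ball 0 (K.R x.1)) →
        Continuous fun w : ℂ × (δ' → ℝ) × (δ' → ℂ) => K.ker k s y a b x w.1 w.2.1 w.2.2 p q F)
    (hO1 : 0 ≤ O1) (hcQa : 0 ≤ cQa) (hcQb : 0 ≤ cQb) (hMF : MF ⊆ analyticClass D.R)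
    -- the face's binders, verbatim, at 𝒯 := cpieceChannel D.toC + cpieceChannel K.toC
    (ρ : ℕ → (ι → ℝ) → Pot) (U₀ : E) (explZ : ℕ → E → (doubleCarriers C₀).Dom → ℝ) (h0 : ScaleZeroFree Ef W)
    (hAdm : AdmissibleTerms Ef W Adm) (hres : AdmRestrict Adm)
    (hPadd : ProjAdditive Adm P) (hPcomm : ProjScaleComm Adm P) (hPinto : ProjInto Adm MF P) (hPsize : ProjSize Adm P κ c)
    (hc : 0 ≤ c)
    (hfac : Factorises Ef W (compProj (cpieceChannel D.toC + cpieceChannel K.toC) P) Ψ) (hclip0 : ∀ k, 0 ≤ clip k)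
    (hCup : ∀ g ∈ W, ∀ g' ∈ W, ∀ (k : ℕ) (U : E) (X : (doubleCarriers C₀).Dom), (doubleCarriers C₀).scale X = k + 1 →
      ∀ Q ∈ 𝒜 k, ∀ γ' ∈ G.vol X,
      ‖act k (g k) U Q γ'‖ ≤ n k (g' k) U γ' ∧
        ‖act k (g k) U Q γ' - act k (g' k) U Q γ'‖ ≤ clip k * |g k - g' k| * n k (g' k) U γ')
    (hqT0 : ∀ k, 0 ≤ qT k)
    (hTcup : ∀ g ∈ W, ∀ g' ∈ W, ∀ (k : ℕ) (y : ι),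
      |compProj (cpieceChannel D.toC + cpieceChannel K.toC) P k g (Ef g) y -
        compProj (cpieceChannel D.toC + cpieceChannel K.toC) P k g' (Ef g) y| ≤
        weightOf D.toC.frame D.κ₁ d0 O1 (D.Kp cdir + K.Kp cK w0 c0 c1) k y * (qT k * |g k - g' k|))
    (hreprV : ∀ (k : ℕ) (s : ℝ) (Q : ι → ℝ) (U : E) (X : (doubleCarriers C₀).Dom),
      Ψ k s Q U X = (G.newTerm act k s U X (ρ k Q)).re - (G.newTerm act k s U₀ X (ρ k Q)).re + explZ k U X)
    (hclipb : ∀ k, clip k ≤ clipbar) (hqTb : ∀ k, qT k ≤ qTbar)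
    (hKP : TwoPointKP G W act 𝒜 n lip a d) (hdec : G.DecayExtract δv d) (hpin : G.PinBudget a δv (fun _ => B) κ)
    (hρ : ∀ (k : ℕ) (Q Q' : ι → ℝ) (M : ℝ),
      (∀ y, |Q y - Q' y| ≤ weightOf D.toC.frame D.κ₁ d0 O1 (D.Kp cdir + K.Kp cK w0 c0 c1) k y * M) →
        ‖ρ k Q - ρ k Q'‖ ≤ M)
    (hexplZ : ∀ (k : ℕ) (U : E) (X : (doubleCarriers C₀).Dom), (doubleCarriers C₀).scale X = k + 1 →
      |explZ k U X| ≤ Real.exp (-(κ * (doubleCarriers C₀).d X)) * p₀ k)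
    (hbase : ∀ g ∈ W, ∀ (U : E) (X : (doubleCarriers C₀).Dom), (doubleCarriers C₀).scale X = 0 →
      |Ef g U X| ≤ Real.exp (-(κ * (doubleCarriers C₀).d X)) * N 0)
    (hNsucc : ∀ j, p₀ j + 2 * B ≤ N (j + 1)) (hNnn : ∀ j, 0 ≤ N j)
    (hbox : ∀ (k : ℕ) (Q : ι → ℝ), (∀ y, |Q y| ≤ weightOf D.toC.frame D.κ₁ d0 O1 (D.Kp cdir + K.Kp cK w0 c0 c1) k y *
      sizeRadius (fun k j => (1 + c) * (tauOfG cQa (agePow ω) + tauOfG cQb (agePow ω)) k j) N k) → ρ k Q ∈ 𝒜 k)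
    (hB : 0 ≤ B) (hlipb : ∀ k, lip k ≤ lipbar) (hω : 0 ≤ ω)
    (hpos : 0 < ω + 8 * lipbar * B * ((1 + c) * (cQa + cQb))) :
    TermSize Ef W κ N ∧
      NE9 Ef W κ (prodModuli (8 * clipbar * B + 8 * lipbar * B * qTbar)
        fun _ => ω + 8 * lipbar * B * ((1 + c) * (cQa + cQb))) ∧
        FadingMemory ((8 * clipbar * B + 8 * lipbar * B * qTbar) / (ω + 8 * lipbar * B * ((1 + c) * (cQa + cQb))))
          (ω + 8 * lipbar * B * ((1 + c) * (cQa + cQb)))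
          (prodModuli (8 * clipbar * B + 8 * lipbar * B * qTbar)
            fun _ => ω + 8 * lipbar * B * ((1 + c) * (cQa + cQb))) :=
  -- species (b)'s S3 binder PRODUCED by (w23) from `KerData.Admissible` (κ₁ ≥ 1, r_k > 0) and (A)/(C)
  have hAb : PieceAdditiveOn (analyticClass K.R) K.toC :=
    pieceAdditiveOn_ker K (lt_of_lt_of_le one_pos hK.κ₁_ge) hK.r_pos hkerA hkerC
  termSize_ne9_and_fadingMemory_species_compProj G hD hℓg hLa hAa hK hκ₁ hR hdY hLb hAb hO1 hcQa hcQb hMF ρ U₀ explZ h0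
    hAdm hres hPadd hPcomm hPinto hPsize hc hfac hclip0 hCup hqT0 hTcup hreprV hclipb hqTb hKP hdec hpin hρ hexplZ hbase hNsucc
    hNnn hbox hB hlipb hω hpos

end Summit.QuantumFields.BalabanUV.T4Continuum.NE9Lemma1SpeciesEndAdditive

end
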